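import Literature.IUT.HodgeArakelov.ThetaEvaluationSettingModelAssembly2
import Literature.AnabelianGeometry.EtaleTheta.Discharge.Sec2InversionFixesDeltaTheta

/-!
# [IUTchII] Prop 2.2 (ii)′ at the MODEL with the binder `hβ` («`ι^Θ ≡ +1` on `Δ̄_Θ`») DISCHARGED from
# «`ι̂` acts as `−1` on `Δ_X^ab`» (GAP row G-w4d010-2, facet (R1e) of D-G-w4d010-2g ⟸ (R1e′))

S. Mochizuki, *Inter-universal Teichmüller theory II*, kurims manuscript (Dec. 2020) §2, Prop. 2.2 (ii) p. 66 («the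
condition of invariance with respect to `ι`»; claim key `Mochizuki2012`, DISPUTED, D-0012). S. Mochizuki, *The étale
theta function …*, Publ. RIMS **45** (2009) (refereed): §2 p. 36 «`ι` … determined by “multiplication by `−1`” on the
underlying elliptic curve», Prop. 2.2 (i) p. 37 («eigenvalues `−1` and `1`»).

PROOF-ONLY companion (cell abc-iut, wave-4 seat abc-iut-w4-d014; NO definitions, NO `Prop`-valued facts; node
**IUTchII:Prop2.2(ii)**) to abc-iut-w4-d010's END-TO-END assembly `ThetaEvaluationSettingModelAssembly2.lean` (p417690)
and abc-iut-w5-d072's `thetaCompanionOfAut` (p416913): the binder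
`hβ : ∀ a ∈ Δ_Θ, ι^Θ(a)·a⁻¹ ∈ l·Δ_Θ` ([EtTh] Prop. 2.2 (i), eigenvalue `+1` on `Δ̄_Θ`; facet (R1e) of
plan/GAP-LEDGER.md D-G-w4d010-2g) of `prop22_ii'_model_of_inversion_of_classLevel` / `prop22_ii'_model_of_thetaKummer`
is REPLACED by the more primitive geometric statement about the datum `ι`
  **(R1e′)** `hinv : ∀ g ∈ Δ_X, ι̂(g)·g ∈ closure [Δ_X, Δ_X]` («`ι̂ = completionAut ι` acts as `−1` on `Δ_X^ab`»),
via abc-iut-w4-d014's `ThetaSetting.ThetaCompanion.thetaIso_mul_inv_mem_lDeltaTheta_of_inversion`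
(`Discharge/Sec2InversionFixesDeltaTheta.lean`: every theta companion of such an `ι` FIXES `Δ_Θ` pointwise — the
class-two identity `⁅a g⁻¹, b h⁻¹⁆ = ⁅g, h⁆` in `Δ_X/closure[[Δ_X,Δ_X],Δ_X]`, i.e. «`Δ_Θ ≅ ∧² Δ^ell`»).
* `prop22_ii'_model_of_inversion_of_classLevel_of_ab` — d010's class-level closing theorem, `hβ ↦ hinv`;
* `prop22_ii'_model_of_thetaKummer_of_ab` — d010's END-TO-END closing theorem, `hβ ↦ hinv`;
* `prop22_ii'_model_of_thetaKummer_of_aut` — moreover the theta companion `c` CONSTRUCTED (d072's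
  `thetaCompanionOfAut ι hΔ hq`): the residual ι-DATUM of node IUTchII:Prop2.2(ii) at the model is then exactly
  (R1a) `hι : ι(Π^tp_X̲̲) = Π^tp_X̲̲` · (R1b′) `hΔ : ι(Δ^tp_X) = Δ^tp_X`, `hq : toTheta` a quotient map · (R1c) `hZ` (the
  `ℤ`-reversal at `γ`) · `δ, hιι` (`ι² = conj δ` on `Π^tp_X̲̲`) · (R1e′) `hinv` — plus the function-level [EtTh] Prop. 1.4
  package, unchanged.
Honest framing: every input about `ι` and every [EtTh] Prop. 1.4 statement stays a hypothesis; nothing here bears on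
[IUTchIII] Cor. 3.12. [claim: Mochizuki2012, status: disputed] typed ≠ proved.
-/

namespace Literature.IUT.HodgeArakelov

open Literature.AnabelianGeometry.EtaleTheta (ContH1 ThetaSetting RootSystem cyclotome)
open Literature.AnabelianGeometry.EtaleTheta
open EtaleThetaDataOfSetting CohomologySystemOfContH1
open scoped commutatorElement

noncomputable section

namespace EtaleThetaDataOfSetting

variable {p : ℕ} [Fact p.Prime] {D : Literature.AnabelianGeometry.EtaleTheta.ThetaSetting p}
  {E : D.EtaleThetaData} {l : ℕ} (C : E.DoubleUnderline l)

section Inversion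

variable (ι : D.PiTemp ≃ₜ* D.PiTemp)

/-- **IUTchII:Prop2.2(ii)′ at the model, class-level inputs, `hβ` DISCHARGED** (kurims p. 66): abc-iut-w4-d010's
`prop22_ii'_model_of_inversion_of_classLevel` with the binder `hβ` («`ι^Θ(a)·a⁻¹ ∈ l·Δ_Θ`», [EtTh] Prop. 2.2 (i))
replaced by (R1e′) `hinv` («`ι̂` acts as `−1` on `Δ_X^ab`») through
`ThetaSetting.ThetaCompanion.thetaIso_mul_inv_mem_lDeltaTheta_of_inversion`; all other binders verbatim.
[claim: Mochizuki2012, status: disputed] (IUTchII §2 Prop 2.2 (ii), kurims pp.65-67) -/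
theorem prop22_ii'_model_of_inversion_of_classLevel_of_ab (hι : C.Huu.map ι.toMulEquiv.toMonoidHom = C.Huu)
    (c : ThetaSetting.ThetaCompanion ι)
    [hN : (PiYdd C).Normal] [hYN : D.GtpYdd.Normal] (hC : D.Compat) (hS : D.Sec2Hyps)
    (hchar : PiYddCharacteristic C) (S : BadPlaceSetting.{0}) (eS : (Pi C) ≃ₜ* S.PiX) (hl : S.l = l)
    {T₀ : TemperedCoverings S (Pi C)}
    (Dec : SubgraphDecomposition S T₀ (etaleThetaDataOfSetting' C hC hS hchar S.toThetaSetting eS hl))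
    -- (R1) the inversion datum
    (γ ε : Pi C) (hγ : C.toLZ γ = Multiplicative.ofAdd 1) (hε₁ : (ε : D.PiTemp) ∈ D.GtpY)
    (hε₂ : (ε : D.PiTemp) ∉ D.GtpYdd) (hZ : D.toZ (ι (γ : D.PiTemp)) = (D.toZ (γ : D.PiTemp))⁻¹)
    (δ : Pi C) (hιι : ∀ x : Pi C, ι (ι (x : D.PiTemp)) = (δ : D.PiTemp) * (x : D.PiTemp) * (δ : D.PiTemp)⁻¹)
    -- (R1e′) «ι̂ acts as −1 on Δ_X^ab»
    (hinv : ∀ g ∈ D.toTemperedCurve.DeltaHat, D.toTemperedCurve.completionAut ι g * g ∈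
      (⁅D.toTemperedCurve.DeltaHat, D.toTemperedCurve.DeltaHat⁆).topologicalClosure)
    -- (R2)/(R3) [EtTh] Prop. 1.4 at the Δ_Θ-class level on `η̈^Θ`
    (h14sign : ∃ κ₁ : ContH1 D.toTheta D.DeltaTheta D.GtpYdd, κ₁ ^ 2 = 1 ∧
      ContH1.conj D.toTheta D.DeltaTheta (ε : D.PiTemp) E.etaDd = E.etaDd * κ₁)
    (h14iota : ContH1Aut.autMap (phi C) D.DeltaTheta (inversionAlpha C ι hι) c.thetaIso
        (thetaCompanion_phi C ι hι c) (thetaCompanion_mem_deltaTheta ι c)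
        (symm_mem_inf_top (PiYdd C) (inversionAlpha C ι hι) (mem_PiYdd_iff_of_piYddCharacteristic C hchar _))
        (ContH1.comap D.toTheta D.DeltaTheta C.Huu.subtype continuous_subtype_val
          (map_subtype_piYdd_inf_le_GtpYdd C ⊤) E.etaDd) =
      ContH1.conj (phi C) D.DeltaTheta ε
        (ContH1.comap D.toTheta D.DeltaTheta C.Huu.subtype continuous_subtype_val
          (map_subtype_piYdd_inf_le_GtpYdd C ⊤) E.etaDd))
    (h14free : ∀ k : ℤ, k ≠ 0 → ¬ IsOfFinOrder
      (ContH1.comap D.toTheta D.DeltaTheta C.Huu.subtype continuous_subtype_val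
        (map_subtype_piYdd_inf_le_GtpYdd C ⊤)
        (ContH1.conj D.toTheta D.DeltaTheta ((γ : D.PiTemp) ^ k) E.etaDd * E.etaDd⁻¹))) :
    Prop22_ii' Dec :=
  prop22_ii'_model_of_inversion_of_classLevel C ι hι c hC hS hchar S eS hl Dec γ ε hγ hε₁ hε₂ hZ δ hιι
    (ThetaSetting.ThetaCompanion.thetaIso_mul_inv_mem_lDeltaTheta_of_inversion D hinv c l)
    h14sign h14iota h14free

/-- **IUTchII:Prop2.2(ii)′ at the model — END-TO-END, `hβ` DISCHARGED** (kurims p. 66): abc-iut-w4-d010's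
`prop22_ii'_model_of_thetaKummer` (p417690) with the binder `hβ` replaced by (R1e′) `hinv`; every other binder —
the inversion datum `(ι, hι, c, hZ, δ, hιι)` and abc-iut-w5-d125's function-level [EtTh] Prop. 1.4 package on a
`ThetaKummerInput` — verbatim. [claim: Mochizuki2012, status: disputed] (IUTchII §2 Prop 2.2 (ii), kurims pp.65-67) -/
theorem prop22_ii'_model_of_thetaKummer_of_ab (hι : C.Huu.map ι.toMulEquiv.toMonoidHom = C.Huu)
    (c : ThetaSetting.ThetaCompanion ι)
    [hN : (PiYdd C).Normal] [hYN : D.GtpYdd.Normal] (hC : D.Compat) (hS : D.Sec2Hyps)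
    (hchar : PiYddCharacteristic C) (S : BadPlaceSetting.{0}) (eS : (Pi C) ≃ₜ* S.PiX) (hl : S.l = l)
    {T₀ : TemperedCoverings S (Pi C)}
    (Dec : SubgraphDecomposition S T₀ (etaleThetaDataOfSetting' C hC hS hchar S.toThetaSetting eS hl))
    -- (R1) the inversion datum
    (γ ε : Pi C) (hγ : C.toLZ γ = Multiplicative.ofAdd 1) (hε₁ : (ε : D.PiTemp) ∈ D.GtpY)
    (hε₂ : (ε : D.PiTemp) ∉ D.GtpYdd) (hZ : D.toZ (ι (γ : D.PiTemp)) = (D.toZ (γ : D.PiTemp))⁻¹)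
    (δ : Pi C) (hιι : ∀ x : Pi C, ι (ι (x : D.PiTemp)) = (δ : D.PiTemp) * (x : D.PiTemp) * (δ : D.PiTemp)⁻¹)
    -- (R1e′) «ι̂ acts as −1 on Δ_X^ab»
    (hinv : ∀ g ∈ D.toTemperedCurve.DeltaHat, D.toTemperedCurve.completionAut ι g * g ∈
      (⁅D.toTemperedCurve.DeltaHat, D.toTemperedCurve.DeltaHat⁆).topologicalClosure)
    -- (R2)(R3) the FUNCTION-level [EtTh] Prop. 1.4 package on t12's `ThetaKummerInput`
    (T : D.ThetaKummerInput) (hη : E.etaDd = T.kummerTheta)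
    (hdeck : ∀ e' : D.PiTemp, e' ∈ D.GtpY → e' ∉ D.GtpYdd → e' • T.theta = T.const (-1) * T.theta)
    (ιFn : T.Fn →* T.Fn)
    (hιFn : ∀ (g : Pi C) (f : T.Fn), ιFn ((g : D.PiTemp) • f) = ι (g : D.PiTemp) • ιFn f)
    (hΛ : ∀ ζ : cyclotome T.Fn, ContH1Aut.coeffMap D.DeltaTheta c.thetaIso (thetaCompanion_mem_deltaTheta ι c)
        (T.coeff.hom ζ) = T.coeff.hom (cyclotome.map ιFn ζ))
    (hιθ : ιFn T.theta = T.const (-1) * T.theta)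
    {udd : T.Fn} (hu : udd ∈ MulAction.fixedPoints D.GtpYdd T.Fn) (xpow : ∀ m : ℤ, RootSystem (udd ^ m))
    (e : ℤ) (he : e ≠ 0)
    (hpow : ∀ k : ℤ, ∃ ck : (↥D.Kdd)ˣ, ((γ : D.PiTemp) ^ k) • T.theta = T.const ck * udd ^ (e * k) * T.theta)
    (hΛbij : Function.Bijective T.coeff.hom)
    (ord : T.Fn →* Multiplicative ℚ) (hordc : ∀ ck, ord (T.const ck) = 1) (hordu : ord udd ≠ 1)
    {d : ℕ} (hd : 0 < d)
    (hint : ∀ f ∈ MulAction.fixedPoints ((PiYdd C ⊓ ⊤).map C.Huu.subtype) T.Fn,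
      ∃ z : ℤ, Multiplicative.toAdd (ord f) = z / d) :
    Prop22_ii' Dec :=
  prop22_ii'_model_of_thetaKummer C hC hS hchar S eS hl Dec ι hι c γ ε hγ hε₁ hε₂ hZ δ hιι
    (ThetaSetting.ThetaCompanion.thetaIso_mul_inv_mem_lDeltaTheta_of_inversion D hinv c l)
    T hη hdeck ιFn hιFn hΛ hιθ hu xpow e he hpow hΛbij ord hordc hordu hd hint

/-- **IUTchII:Prop2.2(ii)′ at the model — END-TO-END with the theta companion CONSTRUCTED and `hβ` DISCHARGED**
(kurims p. 66): `prop22_ii'_model_of_thetaKummer_of_ab` at `c :=` abc-iut-w5-d072's `thetaCompanionOfAut ι hΔ hq`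
([EtTh] Thm. 1.6 (ii) companion of an automorphism preserving `Δ^tp_X`, `toTheta` a quotient map). The residual
ι-DATUM is then (R1a) `hι`, (R1b′) `hΔ`, `hq`, (R1c) `hZ`, `δ`/`hιι`, (R1e′) `hinv` — every one a statement about the
single automorphism `ι` of `Π^tp_X` («the pointed inversion», [IUTchII] Rmk. 1.4.1 (ii)); plus the function-level
[EtTh] Prop. 1.4 package. [claim: Mochizuki2012, status: disputed] (IUTchII §2 Prop 2.2 (ii), kurims pp.65-67) -/
theorem prop22_ii'_model_of_thetaKummer_of_aut (hι : C.Huu.map ι.toMulEquiv.toMonoidHom = C.Huu)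
    (hΔ : D.DeltaTemp.map ι.toMulEquiv.toMonoidHom = D.DeltaTemp) (hq : Topology.IsQuotientMap D.toTheta)
    [hN : (PiYdd C).Normal] [hYN : D.GtpYdd.Normal] (hC : D.Compat) (hS : D.Sec2Hyps)
    (hchar : PiYddCharacteristic C) (S : BadPlaceSetting.{0}) (eS : (Pi C) ≃ₜ* S.PiX) (hl : S.l = l)
    {T₀ : TemperedCoverings S (Pi C)}
    (Dec : SubgraphDecomposition S T₀ (etaleThetaDataOfSetting' C hC hS hchar S.toThetaSetting eS hl))
    -- (R1) the inversion datum
    (γ ε : Pi C) (hγ : C.toLZ γ = Multiplicative.ofAdd 1) (hε₁ : (ε : D.PiTemp) ∈ D.GtpY)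
    (hε₂ : (ε : D.PiTemp) ∉ D.GtpYdd) (hZ : D.toZ (ι (γ : D.PiTemp)) = (D.toZ (γ : D.PiTemp))⁻¹)
    (δ : Pi C) (hιι : ∀ x : Pi C, ι (ι (x : D.PiTemp)) = (δ : D.PiTemp) * (x : D.PiTemp) * (δ : D.PiTemp)⁻¹)
    -- (R1e′) «ι̂ acts as −1 on Δ_X^ab»
    (hinv : ∀ g ∈ D.toTemperedCurve.DeltaHat, D.toTemperedCurve.completionAut ι g * g ∈
      (⁅D.toTemperedCurve.DeltaHat, D.toTemperedCurve.DeltaHat⁆).topologicalClosure)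
    -- (R2)(R3) the FUNCTION-level [EtTh] Prop. 1.4 package on t12's `ThetaKummerInput`
    (T : D.ThetaKummerInput) (hη : E.etaDd = T.kummerTheta)
    (hdeck : ∀ e' : D.PiTemp, e' ∈ D.GtpY → e' ∉ D.GtpYdd → e' • T.theta = T.const (-1) * T.theta)
    (ιFn : T.Fn →* T.Fn)
    (hιFn : ∀ (g : Pi C) (f : T.Fn), ιFn ((g : D.PiTemp) • f) = ι (g : D.PiTemp) • ιFn f)
    (hΛ : ∀ ζ : cyclotome T.Fn, ContH1Aut.coeffMap D.DeltaTheta (D.thetaCompanionOfAut ι hΔ hq).thetaIso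
        (thetaCompanion_mem_deltaTheta ι (D.thetaCompanionOfAut ι hΔ hq))
        (T.coeff.hom ζ) = T.coeff.hom (cyclotome.map ιFn ζ))
    (hιθ : ιFn T.theta = T.const (-1) * T.theta)
    {udd : T.Fn} (hu : udd ∈ MulAction.fixedPoints D.GtpYdd T.Fn) (xpow : ∀ m : ℤ, RootSystem (udd ^ m))
    (e : ℤ) (he : e ≠ 0)
    (hpow : ∀ k : ℤ, ∃ ck : (↥D.Kdd)ˣ, ((γ : D.PiTemp) ^ k) • T.theta = T.const ck * udd ^ (e * k) * T.theta)
    (hΛbij : Function.Bijective T.coeff.hom)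
    (ord : T.Fn →* Multiplicative ℚ) (hordc : ∀ ck, ord (T.const ck) = 1) (hordu : ord udd ≠ 1)
    {d : ℕ} (hd : 0 < d)
    (hint : ∀ f ∈ MulAction.fixedPoints ((PiYdd C ⊓ ⊤).map C.Huu.subtype) T.Fn,
      ∃ z : ℤ, Multiplicative.toAdd (ord f) = z / d) :
    Prop22_ii' Dec :=
  prop22_ii'_model_of_thetaKummer_of_ab C ι hι (D.thetaCompanionOfAut ι hΔ hq) hC hS hchar S eS hl Dec γ ε hγ
    hε₁ hε₂ hZ δ hιι hinv T hη hdeck ιFn hιFn hΛ hιθ hu xpow e he hpow hΛbij ord hordc hordu hd hint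

end Inversion

end EtaleThetaDataOfSetting

end

end Literature.IUT.HodgeArakelov
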